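import Literature.MathematicalPhysics.KineticTheory.HardSphereDLRLowDensity
import HarnessLib

/-!
# Discharge of `HardSphereGibbsLowDensityUniqueness`

(topic MathematicalPhysics/KineticTheory; theorems only — the sibling proof file of
`Georgii1995HardSphereCanonicalLocalLimit.lean`, which cannot import the general-dimension hard-sphere DLR theory
`HardSphereDLR*` itself without an import cycle.)

`HardSphereGibbsLowDensityUniqueness_holds`: for every finite index type `d` and every diameter `ε > 0` there is
`ρ₀ > 0` such that two translation-invariant hard-sphere Gibbs states on `ℝ^d × ℝ^d` with the same Maxwellian marks,
positive activities and the same density `< ρ₀` coincide (Ruelle 1969, Thm 4.2.3, with Georgii 1995, Thm 3.4 and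
Remark 3.7).  For nonempty `d` this is `HardSphereDLR.hardSphereGibbsLowDensityUniqueness_of_nonempty` (GNZ sandwich,
one-point GNZ identity, Lipschitz dependence of the vacancy probability on the activity via pinning and the
activity derivative of the free finite-volume measures, and Michelen–Perkins uniqueness at small activity, all in
general dimension).  For empty `d` the phase space `ℝ^d × ℝ^d` is one point, a configuration is empty or that point,
and a probability law on configurations is determined by its density (`eq_of_density_eq_of_isEmpty`).

## References

* D. Ruelle, *Statistical Mechanics: Rigorous Results*, Benjamin 1969, Thm 4.2.3. [Ruelle1969]
* H.-O. Georgii, J. Stat. Phys. 80 (1995), Thm 3.4, Remark 3.7. [Georgii1995]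
-/

noncomputable section

open MeasureTheory Set Filter Function
open scoped ENNReal NNReal

namespace Literature.MathematicalPhysics.KineticTheory

open Literature.Analysis.FunctionSpaces Literature.Analysis.FluidPDE
open PointProcess (density)

/-! ### Dimension zero: a law on the configurations of a one-point space is determined by its density -/

section DimZero

variable {d : Type*} [IsEmpty d]

/-- In dimension zero the phase space `ℝ^d × ℝ^d` is one point. [folklore] -/
theorem phase_eq_zero_of_isEmpty (p : EuclideanSpace ℝ d × EuclideanSpace ℝ d) : p = 0 := by
  refine Prod.ext ?_ ?_ <;> exact PiLp.ext fun i => isEmptyElim i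

/-- In dimension zero a configuration is empty or the one-point configuration. [folklore] -/
theorem eq_empty_or_eq_ofFn_of_isEmpty (c : PointConfig (EuclideanSpace ℝ d × EuclideanSpace ℝ d)) :
    c = ∅ ∨ c = PointConfig.ofFn (fun _ : Fin 1 => (0 : EuclideanSpace ℝ d × EuclideanSpace ℝ d)) := by
  by_cases h : (0 : EuclideanSpace ℝ d × EuclideanSpace ℝ d) ∈ c
  · refine Or.inr (PointConfig.ext fun p => ?_)
    rw [phase_eq_zero_of_isEmpty p]
    simp only [PointConfig.mem_ofFn, exists_const, iff_true]
    exact h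
  · refine Or.inl (PointConfig.ext fun p => ?_)
    rw [phase_eq_zero_of_isEmpty p]
    simp only [h, false_iff]
    change (0 : EuclideanSpace ℝ d × EuclideanSpace ℝ d) ∉ (∅ : PointConfig (EuclideanSpace ℝ d × EuclideanSpace ℝ d)).carrier
    simp

omit [IsEmpty d] in
/-- The one-point configuration has one point. [folklore] -/
theorem count_univ_ofFn_of_isEmpty :
    (PointConfig.ofFn (fun _ : Fin 1 => (0 : EuclideanSpace ℝ d × EuclideanSpace ℝ d))).count univ = 1 := by
  rw [PointConfig.count, PointConfig.carrier_ofFn, inter_univ, Set.range_const, encard_singleton]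

omit [IsEmpty d] in
/-- The one-point configuration is not empty. [folklore] -/
theorem ofFn_ne_empty_of_isEmpty :
    PointConfig.ofFn (fun _ : Fin 1 => (0 : EuclideanSpace ℝ d × EuclideanSpace ℝ d)) ≠ ∅ := by
  intro h
  have h1 := count_univ_ofFn_of_isEmpty (d := d)
  rw [h, PointConfig.count_empty] at h1
  exact zero_ne_one h1

/-- In dimension zero the counting integrand of the density is the indicator of "nonempty". [folklore] -/
theorem coe_count_unitCube_eq_indicator_of_isEmpty (c : PointConfig (EuclideanSpace ℝ d × EuclideanSpace ℝ d)) :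
    ((c.count (Prod.fst ⁻¹' Torus.unitCube d) : ℕ∞) : ℝ≥0∞) =
      ({c : PointConfig (EuclideanSpace ℝ d × EuclideanSpace ℝ d) | c.count univ = 0}ᶜ).indicator 1 c := by
  have hcube : (Prod.fst ⁻¹' Torus.unitCube d : Set (EuclideanSpace ℝ d × EuclideanSpace ℝ d)) = univ :=
    eq_univ_of_forall fun p i => isEmptyElim i
  rw [hcube]
  rcases eq_empty_or_eq_ofFn_of_isEmpty c with rfl | rfl
  · have hmem : (∅ : PointConfig (EuclideanSpace ℝ d × EuclideanSpace ℝ d)) ∉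
        ({c : PointConfig (EuclideanSpace ℝ d × EuclideanSpace ℝ d) | c.count univ = 0}ᶜ) := fun h =>
      h (show (∅ : PointConfig (EuclideanSpace ℝ d × EuclideanSpace ℝ d)).count univ = 0 from PointConfig.count_empty _)
    rw [PointConfig.count_empty, indicator_of_notMem hmem]
    simp
  · rw [indicator_of_mem (show _ ∈ {c : PointConfig (EuclideanSpace ℝ d × EuclideanSpace ℝ d) | c.count univ = 0}ᶜ by
        rw [mem_compl_iff, mem_setOf_eq, count_univ_ofFn_of_isEmpty]; exact one_ne_zero),
      Pi.one_apply, count_univ_ofFn_of_isEmpty]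
    simp

omit [IsEmpty d] in
/-- The event "no point" is measurable. [folklore] -/
theorem measurableSet_count_univ_eq_zero_of_isEmpty :
    MeasurableSet {c : PointConfig (EuclideanSpace ℝ d × EuclideanSpace ℝ d) | c.count univ = 0} :=
  PointConfig.measurable_count MeasurableSet.univ (measurableSet_singleton 0)

/-- In dimension zero the density of a law is the probability of "some point". [folklore] -/
theorem density_eq_measure_compl_of_isEmpty (μ : Measure (PointConfig (EuclideanSpace ℝ d × EuclideanSpace ℝ d))) :
    density μ = μ {c : PointConfig (EuclideanSpace ℝ d × EuclideanSpace ℝ d) | c.count univ = 0}ᶜ := by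
  rw [density]
  simp_rw [coe_count_unitCube_eq_indicator_of_isEmpty]
  exact lintegral_indicator_one measurableSet_count_univ_eq_zero_of_isEmpty.compl

/-- **In dimension zero a probability law on configurations is determined by its density.** [folklore] -/
theorem eq_of_density_eq_of_isEmpty {μ μ' : Measure (PointConfig (EuclideanSpace ℝ d × EuclideanSpace ℝ d))}
    [IsProbabilityMeasure μ] [IsProbabilityMeasure μ'] (h : density μ = density μ') : μ = μ' := by
  classical
  set S : Set (PointConfig (EuclideanSpace ℝ d × EuclideanSpace ℝ d)) := {c | c.count univ = 0} with hS
  have hSm : MeasurableSet S := measurableSet_count_univ_eq_zero_of_isEmpty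
  rw [density_eq_measure_compl_of_isEmpty, density_eq_measure_compl_of_isEmpty] at h
  have hS' : μ S = μ' S := by
    have h1 := measure_compl hSm (measure_ne_top μ S)
    have h2 := measure_compl hSm (measure_ne_top μ' S)
    rw [measure_univ] at h1 h2
    have hμS : μ S ≤ 1 := prob_le_one
    have hμ'S : μ' S ≤ 1 := prob_le_one
    rw [← hS] at h
    rw [h1, h2] at h
    exact (ENNReal.sub_right_inj ENNReal.one_ne_top hμS hμ'S).1 h
  -- `S = {∅}` and `Sᶜ = {pt}`: every event is `∅`, `S`, `Sᶜ` or `univ` up to these atoms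
  have hmemS : ∀ c : PointConfig (EuclideanSpace ℝ d × EuclideanSpace ℝ d), c ∈ S ↔ c = ∅ := fun c => by
    rcases eq_empty_or_eq_ofFn_of_isEmpty c with rfl | rfl
    · simp [hS, PointConfig.count_empty]
    · simp only [hS, mem_setOf_eq, count_univ_ofFn_of_isEmpty, one_ne_zero, false_iff]
      exact ofFn_ne_empty_of_isEmpty
  refine Measure.ext fun A hAm => ?_
  have hdecomp : ∀ ν : Measure (PointConfig (EuclideanSpace ℝ d × EuclideanSpace ℝ d)), ν A = ν (A ∩ S) + ν (A ∩ Sᶜ) :=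
    fun ν => (measure_inter_add_sdiff₀ A hSm.nullMeasurableSet).symm.trans (by rw [sdiff_eq])
  have hAS : A ∩ S = if (∅ : PointConfig (EuclideanSpace ℝ d × EuclideanSpace ℝ d)) ∈ A then S else ∅ := by
    split_ifs with h0
    · refine inter_eq_right.2 fun c hc => ?_
      rw [(hmemS c).1 hc]; exact h0
    · refine eq_empty_of_forall_notMem fun c hc => h0 ?_
      rw [← (hmemS c).1 hc.2]; exact hc.1
  have hASc : A ∩ Sᶜ = if PointConfig.ofFn (fun _ : Fin 1 => (0 : EuclideanSpace ℝ d × EuclideanSpace ℝ d)) ∈ A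
      then Sᶜ else ∅ := by
    have hmemSc : ∀ c : PointConfig (EuclideanSpace ℝ d × EuclideanSpace ℝ d), c ∈ Sᶜ ↔
        c = PointConfig.ofFn (fun _ : Fin 1 => (0 : EuclideanSpace ℝ d × EuclideanSpace ℝ d)) := fun c => by
      rw [mem_compl_iff, hmemS]
      rcases eq_empty_or_eq_ofFn_of_isEmpty c with rfl | rfl
      · simpa using ofFn_ne_empty_of_isEmpty.symm
      · simpa using ofFn_ne_empty_of_isEmpty
    split_ifs with h0
    · refine inter_eq_right.2 fun c hc => ?_
      rw [(hmemSc c).1 hc]; exact h0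
    · refine eq_empty_of_forall_notMem fun c hc => h0 ?_
      rw [← (hmemSc c).1 hc.2]; exact hc.1
  rw [hdecomp μ, hdecomp μ', hAS, hASc]
  have hSc : μ Sᶜ = μ' Sᶜ := h
  split_ifs <;> simp [hS', hSc]

end DimZero

/-! ### The discharge -/

/-- **Uniqueness of the translation-invariant hard-sphere Gibbs state at low density** (Ruelle 1969, Thm 4.2.3, with
Georgii 1995, Thm 3.4 and Remark 3.7): discharge of the named fact `HardSphereGibbsLowDensityUniqueness`.
Nonempty `d`: `HardSphereDLR.hardSphereGibbsLowDensityUniqueness_of_nonempty`; empty `d`: `eq_of_density_eq_of_isEmpty`.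
[cite: Ruelle1969, Thm 4.2.3 (with Georgii 1995, Thm 3.4 and Remark 3.7)] -/
theorem HardSphereGibbsLowDensityUniqueness_holds : HardSphereGibbsLowDensityUniqueness := by
  intro d _ ε hε
  rcases isEmpty_or_nonempty d with hd | hd
  · refine ⟨1, one_pos, fun β u z z' G G' _ _ _ hG hG' _ _ hdens _ => ?_⟩
    haveI := hG.1
    haveI := hG'.1
    exact eq_of_density_eq_of_isEmpty hdens
  · exact HardSphereDLR.hardSphereGibbsLowDensityUniqueness_of_nonempty ε hε

end Literature.MathematicalPhysics.KineticTheory
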